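import Literature.AlgebraicGeometry.Resolution.InseparableLocalUniformizationStepsThreeFourHolds
import HarnessLib

/-!
# Inseparable local uniformization: the frontier of the induction step on the transcendence defect

Topic: `Literature/AlgebraicGeometry/Resolution`. M. Temkin, *Inseparable local uniformization*,
J. Algebra 373 (2013) 65–119 = arXiv:0804.1554v3, proof of Thm. 4.1.1 (pp. 47–50; pp. 29–30 of
the 41-pp. arXiv version held in the literature store).

The named fact `Temkin2013DescentDefectStep` (`InseparableLocalUniformizationDefect.lean`) is the
induction step of the proof of Thm. 4.1.1 (`n = 1`, non-logarithmic form): Thm. 4.1.1 for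
valued fields of transcendence defect `≤ d` implies it for transcendence defect `≤ d + 1`
(Steps 1–4, pp. 47–50). After the files `…DefectStep.lean` (Steps 0–2 and the induction),
`…DefectStepTower.lean` (re-threading through the corrected Steps 3–4 fact
`Temkin2013_Steps34_tower`), `…StepThree.lean`, `…StepFour.lean`, `…StepsThreeFourWeak.lean`,
`…SimplePoint.lean`, `…StepsThreeFourHolds.lean` (Steps 3–4 PROVED:
`Temkin2013_Steps34_tower_holds`, from Lemmas 2.8.4/2.8.5, the openness of `Spec m° ⊂ Nr_m(S)`,
descent of smoothness over a field and the final enlargement of `l` — all discharged) and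
`Temkin2013CurveSmoothingProofs.lean` (Step 1 of the proof of Thm. 3.3.1 PROVED:
`Temkin2013CurveSmoothing_holds`), exactly ONE printed ingredient of these steps remains a
named fact:

* `Temkin2013RelativeCurveSmoothFibre` (`InseparableLocalUniformizationCurvesStepOne.lean`) —
  Thm. 3.3.1 (`n = 1`) for `k`-smooth generic fibres, i.e. Steps 2–3 and the conclusion of its
  proof (pp. 44–45 of v3; pp. 27–28 of the held copy): Berkovich-analytic generic fibres of the
  `π`-adic completion, the analytic inseparable uniformization of terminal points Thm. 3.2.6
  (whose proof rests on the stable modification / semistable reduction theorem), Krasner's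
  lemma, algebraization of a Weierstrass domain, and Thm. 2.8.2 (ii). None of this analytic
  geometry (affinoid algebras `𝓜(𝒜)`, Berkovich curves, semistable reduction) exists in Mathlib,
  so this fact is the finest faithful rendering currently statable; it is NOT decomposed further
  here.

This leaf file records the resulting one-fact frontier:

* `Temkin2013DescentDefectStep.of_smoothFibre :
    Temkin2013RelativeCurveSmoothFibre → Temkin2013DescentDefectStep` — PROVED;
* `Temkin2013DescentDefectLE.of_abhyankar_smoothFibre` — every level of the defect filtration
  from the Abhyankar base (`Temkin2013DescentAbhyankar`, Thm. 5.5.2 (i)) and that one fact.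

## Sources

* M. Temkin, *Inseparable local uniformization*, arXiv:0804.1554v3: proof of Thm. 4.1.1, Steps
  0–4 (pp. 47–50); Thm. 3.3.1 and its proof (pp. 44–45); Thm. 3.2.6 (p. 43).
-/

noncomputable section

namespace Literature.AlgebraicGeometry.Resolution

universe u

/-- **The induction step on the transcendence defect (Temkin 2013, Thm. 4.1.1, Steps 1–4) from
ONE named fact**: Thm. 3.3.1 for smooth generic fibres (`Temkin2013RelativeCurveSmoothFibre`,
Berkovich-analytic). Every other printed ingredient — curve smoothing (Step 1 of Thm. 3.3.1),
Steps 0–2 of Thm. 4.1.1, Lemma 2.8.4, Lemma 2.8.5, the openness of `Spec m°` in `Nr_m(S)`,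
descent of smoothness along smooth covers over a field, the final enlargement of `l` — is a
theorem of the tree (`Temkin2013CurveSmoothing_holds`, `Temkin2013_Steps34_tower_holds`,
`Temkin2013DescentDefectStep.of_curve_frontier_tower`).
[cite: Temkin2013, Thm. 4.1.1, proof, Steps 1–4 (arXiv:0804.1554v3 pp. 47–50)] -/
theorem Temkin2013DescentDefectStep.of_smoothFibre (hsf : Temkin2013RelativeCurveSmoothFibre.{u}) :
    Temkin2013DescentDefectStep.{u} :=
  Temkin2013DescentDefectStep.of_curve_frontier_tower Temkin2013CurveSmoothing_holds hsf
    Temkin2013_Steps34_tower_holds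

/-- **Every level of the defect filtration** `Temkin2013DescentDefectLE d` (Thm. 4.1.1, `n = 1`,
non-logarithmic, for transcendence defect `≤ d`) from the induction base
(`Temkin2013DescentAbhyankar`: Abhyankar valuations, Thm. 5.5.2 (i)) and Thm. 3.3.1 for smooth
generic fibres. [cite: Temkin2013, Thm. 4.1.1, proof, Step 0 (p. 47)] -/
theorem Temkin2013DescentDefectLE.of_abhyankar_smoothFibre (h0 : Temkin2013DescentAbhyankar.{u})
    (hsf : Temkin2013RelativeCurveSmoothFibre.{u}) (d : ℕ) : Temkin2013DescentDefectLE.{u} d :=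
  Temkin2013DescentDefectLE.of_step h0 (Temkin2013DescentDefectStep.of_smoothFibre hsf) d

/-- Modulo the Abhyankar base, Thm. 4.1.1 (`n = 1`, descent form) follows from that one fact
(cf. `Temkin2013Descent.of_abhyankar_smoothFibre`, which takes the stronger Thm. 5.5.2 (i)
rendering `Temkin2013Abhyankar`). [cite: Temkin2013, Thm. 4.1.1, proof (pp. 47–50)] -/
theorem Temkin2013Descent.of_descentAbhyankar_smoothFibre (h0 : Temkin2013DescentAbhyankar.{u})
    (hsf : Temkin2013RelativeCurveSmoothFibre.{u}) : Temkin2013Descent.{u} :=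
  Temkin2013Descent.of_defect h0 (Temkin2013DescentDefectStep.of_smoothFibre hsf)

end Literature.AlgebraicGeometry.Resolution
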